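import Summits.NavierStokesRegularity.NavierStokesRegularity.Theses.TypeIQuarterGate
import Summits.NavierStokesRegularity.NavierStokesRegularity.Theorems.TypeIQuarterGateQuarterLawCountsScarsCriterion
import Summits.NavierStokesRegularity.NavierStokesRegularity.Theorems.StretchingWellBindingEnstrophyQuarterLawToEnergyHalfHolder
import HarnessLib

/-!
# `TypeIQuarterGate.QuarterLawCountsScars` (item stmt-NavierStokesRegularity-23912): the quarter law
# counts scars

**Statement (the route decl, verbatim).** A classical solution of the unforced Navier–Stokes system on
`ℝ³ × [0,T)` (viscosity `ν > 0`), Leray–Hopf from its rapidly decaying datum, obeying Leray's quarter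
rate `∫ ‖curl u(t)‖² ≤ K/√(T−t)` on `[0,T)`, has finitely many singular points at `T`: off a finite set
`σ` every point `x` has `‖u‖ ≤ A` on `[T − r², T) × B_r(x)` for some `r > 0`.

PROOF. (1) Slice law ⇒ window law `∫_a^b ∫ |curl u|² ≤ 2K⁺ √(b − a)`
(`WindowConverters.lintegral_Ioo_le_sqrt_of_slice_le`). (2) The regularity criterion under the window law
(`QuarterLawCountsScars.bounded_near_of_small_dissipation`: ONE final cylinder `(T−ϱ²/ν,T) × B_ϱ(x)`,
`ϱ < ϱ₁`, dissipating `≤ η₁ ϱ` makes `x` regular — CKN Prop. 1 in the `E`-currency under the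
centre-uniform scaled bounds the window law provides). (3) COUNTING: the "bad" points (every cylinder of
radius `ϱ < ϱ₁` dissipates `> η₁ ϱ`) are finite — for `m` bad points and `ϱ` below half their mutual
distances the cylinders are disjoint, so `m η₁ ϱ < ∫_{T−ϱ²/ν}^{T} ∫ |∇u|_F² ≤ 2K⁺ √(ϱ²/ν)`
(`HolderBridge.lintegral_cylinder_frobeniusNormSq_le_of_window`), i.e. `m ≤ 2K⁺/(√ν η₁)`; an infinite
bad set would contain `⌊2K⁺/(√ν η₁)⌋ + 1` points (`Set.Infinite.exists_subset_card_eq`). Every point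
off the bad set is regular by (2).

HONEST FRAMING: bookkeeping along ONE hypothetical solution obeying the (open) quarter law; the cruxes
`QuarterLawTypeI` (23726) / `FiniteScarsTypeI` (23842) are NOT touched and nothing about Navier–Stokes
regularity or blow-up is claimed. [cite: CaffarelliKohnNirenberg1982, Proposition 1 and Theorem B]
[cite: Leray1934, §20]
-/

-- the problem directory repeats the summit name (`NavierStokesRegularity/NavierStokesRegularity`)
set_option linter.dupNamespace false

noncomputable section

namespace Summit.NavierStokesRegularity.NavierStokesRegularity.Theorems

namespace QuarterLawCountsScars

open Set MeasureTheory Function Metric Filter Topology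
open scoped ENNReal NNReal
open Literature.Analysis.FluidPDE

/-- **The quarter law counts scars** (item content): classical solution on `[0,T)`, Leray–Hopf,
rapidly decaying datum, `∫ ‖curl u(t)‖² ≤ K/√(T−t)` on `[0,T)` ⇒ off a finite set every point is regular
at the final time. [cite: CaffarelliKohnNirenberg1982, Proposition 1 and Theorem B] -/
theorem main (ν T : ℝ) (hν : 0 < ν) (hT : 0 < T)
    (u : ℝ → EuclideanSpace ℝ (Fin 3) → EuclideanSpace ℝ (Fin 3))
    (p : ℝ → EuclideanSpace ℝ (Fin 3) → ℝ)
    (hsol : IsClassicalNSSolutionOn (Ico 0 T) ν 0 u p) (hLH : IsLerayHopfOn T ν 0 (u 0) u)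
    (K : ℝ)
    (hq : ∀ t ∈ Ico 0 T, ∫⁻ x, ‖curl (u t) x‖ₑ ^ 2 ≤ ENNReal.ofReal (K / Real.sqrt (T - t))) :
    ∃ σ : Finset (EuclideanSpace ℝ (Fin 3)), ∀ x ∉ σ, ∃ r : ℝ, 0 < r ∧ ∃ A : ℝ,
      ∀ t ∈ Ico (T - r ^ 2) T, ∀ y ∈ ball x r, ‖u t y‖ ≤ A := by
  classical
  -- (1) the window law with the non-negative constant `2 K⁺`
  set K' : ℝ := max K 0 with hK'
  have hK'0 : 0 ≤ K' := le_max_right _ _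
  have hq' : ∀ t ∈ Ico 0 T, ∫⁻ x, ‖curl (u t) x‖ₑ ^ 2 ≤ ENNReal.ofReal (K' / Real.sqrt (T - t)) :=
    fun t ht => (hq t ht).trans (ENNReal.ofReal_le_ofReal
      (div_le_div_of_nonneg_right (le_max_left _ _) (Real.sqrt_nonneg _)))
  have hwin : ∀ a b : ℝ, 0 ≤ a → a ≤ b → b ≤ T →
      ∫⁻ t in Ioo a b, ∫⁻ x, ‖curl (u t) x‖ₑ ^ 2 ≤ ENNReal.ofReal (2 * K' * Real.sqrt (b - a)) :=
    fun a b ha hab hb =>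
      WindowConverters.lintegral_Ioo_le_sqrt_of_slice_le (Z := fun t => ∫⁻ x, ‖curl (u t) x‖ₑ ^ 2)
        hK'0 hq' ha hab hb
  -- (2) the regularity criterion
  obtain ⟨η₁, ϱ₁, hη₁, hϱ₁, hcrit⟩ :=
    bounded_near_of_small_dissipation hν hT hsol hLH (by positivity : (0 : ℝ) ≤ 2 * K') hwin
  -- the physical dissipation of the final cylinder of radius `ϱ` at `x`
  set Phys : ℝ → EuclideanSpace ℝ (Fin 3) → ℝ≥0∞ := fun ϱ x =>
    ∫⁻ w in Ioo (T - ν⁻¹ * ϱ ^ 2) T ×ˢ ball x ϱ,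
      ENNReal.ofReal (frobeniusNormSq (fderiv ℝ (u w.1) w.2)) with hPhys
  -- (3) the bad set: every small final cylinder concentrates
  set Bad : Set (EuclideanSpace ℝ (Fin 3)) :=
    {x | ∀ ϱ ∈ Ioo 0 ϱ₁, ENNReal.ofReal (η₁ * ϱ) < Phys ϱ x} with hBad
  -- scales: `ϱ₂ ≤ ϱ₁` with `ν⁻¹ ϱ₂² ≤ T`
  set ϱ₂ : ℝ := min ϱ₁ (Real.sqrt (ν * T)) with hϱ₂
  have hϱ₂pos : 0 < ϱ₂ := lt_min hϱ₁ (Real.sqrt_pos.2 (mul_pos hν hT))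
  have hϱ₂1 : ϱ₂ ≤ ϱ₁ := min_le_left _ _
  have hϱ₂T : ν⁻¹ * ϱ₂ ^ 2 ≤ T := by
    have h1 : ϱ₂ ^ 2 ≤ ν * T := by
      have h := pow_le_pow_left₀ hϱ₂pos.le (min_le_right ϱ₁ (Real.sqrt (ν * T))) 2
      rwa [Real.sq_sqrt (mul_pos hν hT).le] at h
    calc ν⁻¹ * ϱ₂ ^ 2 ≤ ν⁻¹ * (ν * T) := mul_le_mul_of_nonneg_left h1 (inv_pos.2 hν).le
      _ = T := by rw [← mul_assoc, inv_mul_cancel₀ hν.ne', one_mul]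
  -- the counting bound
  set N₀ : ℕ := ⌊2 * K' * Real.sqrt ν⁻¹ / η₁⌋₊ with hN₀
  have hcount : ∀ F : Finset (EuclideanSpace ℝ (Fin 3)), (↑F : Set _) ⊆ Bad → F.card ≤ N₀ := by
    intro F hF
    -- a common radius `ϱ < ϱ₂` below half of all mutual distances
    have hev : ∀ᶠ ϱ in 𝓝[>] (0 : ℝ), ϱ < ϱ₂ ∧ ∀ pr ∈ F.offDiag, 2 * ϱ < dist pr.1 pr.2 := by
      refine (eventually_nhdsWithin_of_eventually_nhds (eventually_lt_nhds hϱ₂pos)).and ?_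
      refine (F.offDiag.eventually_all).2 fun pr hpr => ?_
      have hne : pr.1 ≠ pr.2 := (Finset.mem_offDiag.1 hpr).2.2
      have hd : 0 < dist pr.1 pr.2 / 2 := half_pos (dist_pos.2 hne)
      refine eventually_nhdsWithin_of_eventually_nhds ((eventually_lt_nhds hd).mono fun ϱ hϱ => ?_)
      linarith
    obtain ⟨ϱ, ⟨hϱ2, hsep⟩, hϱ0⟩ := (hev.and self_mem_nhdsWithin).exists
    have hϱ0' : 0 < ϱ := hϱ0
    have hϱ1 : ϱ ∈ Ioo 0 ϱ₁ := ⟨hϱ0', lt_of_lt_of_le hϱ2 hϱ₂1⟩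
    -- the cylinders are pairwise disjoint
    set cyl : EuclideanSpace ℝ (Fin 3) → Set (ℝ × EuclideanSpace ℝ (Fin 3)) := fun x =>
      Ioo (T - ν⁻¹ * ϱ ^ 2) T ×ˢ ball x ϱ with hcyl
    have hdisj : Set.PairwiseDisjoint (↑F : Set (EuclideanSpace ℝ (Fin 3))) cyl := by
      intro x hx x' hx' hne
      have h2 : 2 * ϱ < dist x x' := hsep (x, x') (Finset.mem_offDiag.2 ⟨hx, hx', hne⟩)
      have hballs : Disjoint (ball x ϱ) (ball x' ϱ) := ball_disjoint_ball (by linarith)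
      rw [Function.onFun, hcyl]
      exact Set.disjoint_prod.2 (Or.inr hballs)
    have hmeas : ∀ x ∈ F, MeasurableSet (cyl x) := fun x _ => measurableSet_Ioo.prod measurableSet_ball
    -- lower bound: each bad cylinder concentrates
    have hlow : (F.card : ℝ≥0∞) * ENNReal.ofReal (η₁ * ϱ) ≤ ∑ x ∈ F, Phys ϱ x := by
      rw [← nsmul_eq_mul, ← Finset.sum_const]
      exact Finset.sum_le_sum fun x hx => (hF (Finset.mem_coe.2 hx) ϱ hϱ1).le
    -- upper bound: the window law on the slab `(T − ν⁻¹ϱ², T) × ℝ³`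
    have ha : 0 ≤ T - ν⁻¹ * ϱ ^ 2 := by
      have h1 : ν⁻¹ * ϱ ^ 2 ≤ ν⁻¹ * ϱ₂ ^ 2 :=
        mul_le_mul_of_nonneg_left (pow_le_pow_left₀ hϱ0'.le hϱ2.le 2) (inv_pos.2 hν).le
      linarith
    have hab : T - ν⁻¹ * ϱ ^ 2 ≤ T := by
      have : 0 ≤ ν⁻¹ * ϱ ^ 2 := by positivity
      linarith
    have hup : ∑ x ∈ F, Phys ϱ x ≤ ENNReal.ofReal (2 * K' * Real.sqrt (T - (T - ν⁻¹ * ϱ ^ 2))) := by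
      have hsum : ∑ x ∈ F, Phys ϱ x = ∫⁻ w in ⋃ x ∈ F, cyl x,
          ENNReal.ofReal (frobeniusNormSq (fderiv ℝ (u w.1) w.2)) := by
        rw [lintegral_biUnion_finset hdisj hmeas]
      rw [hsum]
      refine (lintegral_mono_set (μ := volume) (show (⋃ x ∈ F, cyl x) ⊆
        Ioo (T - ν⁻¹ * ϱ ^ 2) T ×ˢ (univ : Set (EuclideanSpace ℝ (Fin 3))) from ?_)).trans ?_
      · intro w hw
        obtain ⟨x, -, hwx⟩ := Set.mem_iUnion₂.1 hw
        exact ⟨hwx.1, mem_univ _⟩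
      · exact HolderBridge.lintegral_cylinder_frobeniusNormSq_le_of_window hν hsol hLH ha le_rfl
          (hwin _ _ ha hab le_rfl) univ
    have hsq : Real.sqrt (T - (T - ν⁻¹ * ϱ ^ 2)) = Real.sqrt ν⁻¹ * ϱ := by
      rw [sub_sub_cancel, Real.sqrt_mul (inv_pos.2 hν).le, Real.sqrt_sq hϱ0'.le]
    rw [hsq] at hup
    -- combine in `ℝ`
    have hle : (F.card : ℝ≥0∞) * ENNReal.ofReal (η₁ * ϱ) ≤
        ENNReal.ofReal (2 * K' * (Real.sqrt ν⁻¹ * ϱ)) := hlow.trans hup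
    rw [← ENNReal.ofReal_natCast, ← ENNReal.ofReal_mul (Nat.cast_nonneg _),
      ENNReal.ofReal_le_ofReal_iff (by positivity)] at hle
    have hreal : (F.card : ℝ) ≤ 2 * K' * Real.sqrt ν⁻¹ / η₁ := by
      rw [le_div_iff₀ hη₁]
      have := hle
      nlinarith [hϱ0', this]
    exact Nat.le_floor hreal
  -- the bad set is finite
  have hfin : Bad.Finite := by
    by_contra hinf
    obtain ⟨F, hF, hcard⟩ := Set.Infinite.exists_subset_card_eq hinf (N₀ + 1)
    have := hcount F hF
    omega
  refine ⟨hfin.toFinset, fun x hx => ?_⟩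
  have hxB : x ∉ Bad := fun h => hx (hfin.mem_toFinset.2 h)
  simp only [hBad, mem_setOf_eq, not_forall, not_lt, exists_prop] at hxB
  obtain ⟨ϱ, hϱ, hle⟩ := hxB
  exact hcrit x ϱ hϱ hle

end QuarterLawCountsScars

/-- **Item stmt-NavierStokesRegularity-23912** (`TypeIQuarterGate.QuarterLawCountsScars`): a classical
Leray–Hopf solution on `[0,T)` from a rapidly decaying datum obeying `∫ ‖curl u(t)‖² ≤ K/√(T−t)` has
finitely many singular points at `T`. Bookkeeping along a hypothetical solution; nothing about
Navier–Stokes regularity or blow-up is asserted. [cite: CaffarelliKohnNirenberg1982, Theorem B] -/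
theorem typeIQuarterGate_quarterLawCountsScars_proof :
    Summit.NavierStokesRegularity.NavierStokesRegularity.Theses.TypeIQuarterGate.QuarterLawCountsScars := by
  unfold Summit.NavierStokesRegularity.NavierStokesRegularity.Theses.TypeIQuarterGate.QuarterLawCountsScars
  intro ν T hν hT u p hsol hLH _hdec K hq
  exact QuarterLawCountsScars.main ν T hν hT u p hsol hLH K hq

end Summit.NavierStokesRegularity.NavierStokesRegularity.Theorems

end
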